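import Summits.AtomisticToContinuum.Crystallization.Theorems.FrustratedLawDichotomySignedLedgerSaturated

/-!
# FrustratedLawDichotomy · crux `AperiodicFrustratedLawGap` (stmt-AtomisticToContinuum-27623) — SATURATION IS FREE, DEFECTS HAVE DENSITY (Palm dichotomy)
# (decomp-a2c hand-2 g45, STRUCTURAL share #54: DEF-FREE companion of `…SignedLedgerSaturated`)

Two consequences of POINT-STATIONARITY (the Mecke / mass-transport identity `IsPointStationaryLaw`) for the saturated regimes of
`…SignedLedgerSaturated`, with NO new definitions:

* §1 ★ `ae_forall_reroot_of_ae` — **saturation is free**: for a point-stationary law a.s. carried by rooted `δ`-hard-core configurations and a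
  MEASURABLE set `C` of measures, `μ ∈ C` almost surely ⟹ almost surely EVERY re-rooting `θ_p μ` at an atom lies in `C` (mass transport: each atom
  whose re-rooting leaves `C` sends unit mass to the root; the received mass is `#atoms · 𝟙_{Cᶜ}(μ) = 0` a.s.).  With the root this is an iff
  (`ae_forall_reroot_iff_ae`).
* §2 ★ `measure_ne_zero_of_ae_exists_reroot` — **marks seen from somewhere are seen from the root with positive probability**: if almost surely
  SOME atom `p` has `θ_p μ ∈ D` (measurable `D`), then `P D ≠ 0` — the tree's `…TransportPriceMarked.measure_pos_of_dense_marks` WITHOUT the bounded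
  distance `‖q‖ ≤ L` (no ergodicity needed).
* §3 ★ `ae_forall_reroot_or_measure_compl_ne_zero` — **the Palm dichotomy under the residual's ergodicity clause** (verbatim): for measurable `C`,
  EITHER almost surely every atom's re-rooting lies in `C` («coherent everywhere»), OR the root itself violates `C` with positive probability,
  `P Cᶜ ≠ 0` (equivalently `0 < P.real Cᶜ`, `measureReal_compl_pos_of_not_ae_forall_reroot`) — a POSITIVE DENSITY of defect roots, which is what
  makes the bad-root credit `σ · P(bad)` of a `LawLedger` bite.
* §4 `nonempty_lawLedger_of_coherent_or_defectDensity` — the two-regime E′ assembly by name: a ledger for laws coherent everywhere (lens-5's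
  single-grain piece) and a ledger for laws with a positive density of defect roots give a ledger for every ergodic admissible law.

Tags: [folklore: Palm calculus / mass transport].
-/

noncomputable section

namespace Summit.AtomisticToContinuum.Crystallization.Theorems.FrustratedLawDichotomySignedLedgerSaturation

open MeasureTheory Metric Set Filter TopologicalSpace ProbabilityTheory
open scoped ENNReal Topology BigOperators
open Literature.Probability.Process
open Summit.AtomisticToContinuum.Crystallization.Theorems.ChargedEnergyGapNegative (E3)
open Summit.AtomisticToContinuum.Crystallization.Theorems.FrustratedLawDichotomySignedLedger (LawLedger)
open Summit.AtomisticToContinuum.Crystallization.Theorems.FrustratedLawDichotomySignedLedgerSaturated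
  (lintegral_reroot_eq_zero_iff exists_version_forall_reroot)
open Summit.AtomisticToContinuum.Crystallization.Theorems.FrustratedLawDichotomyFiniteClusterGap
  (ae_mem_of_sep exists_kernel_eq_count_restrict measurable_kernel_map_sub)

variable {δ : ℝ} {P : Measure (Measure E3)}

/-- The test function of a complement: `Cᶜ.indicator 1 ν = 0 ↔ ν ∈ C`. [folklore] -/
theorem indicator_compl_one_eq_zero_iff {C : Set (Measure E3)} (ν : Measure E3) :
    Cᶜ.indicator (1 : Measure E3 → ℝ≥0∞) ν = 0 ↔ ν ∈ C := by
  rw [indicator_apply_eq_zero]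
  simp only [mem_compl_iff, Pi.one_apply, one_ne_zero, imp_false, not_not]

/-! ## §1. Saturation is free under point-stationarity -/

/-- **SATURATION IS FREE.**  For a point-stationary law almost surely carried by rooted `δ`-hard-core configurations (`δ > 0`) and a measurable
set `C` of measures: if `μ ∈ C` almost surely, then almost surely every re-rooting of `μ` at one of its atoms lies in `C`. [folklore: mass transport] -/
theorem ae_forall_reroot_of_ae (hδ : 0 < δ) (hcore : ∀ᵐ μ ∂P, IsRootedHardCore δ μ) (hstat : IsPointStationaryLaw P)
    {C : Set (Measure E3)} (hC : MeasurableSet C) (h : ∀ᵐ μ ∂P, μ ∈ C) :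
    ∀ᵐ μ ∂P, ∀ p : E3, μ {p} ≠ 0 → Measure.map (fun z : E3 => z - p) μ ∈ C := by
  obtain ⟨κ, hκs, hκ⟩ := exists_kernel_eq_count_restrict hδ
  haveI := hκs
  have hκ_of : ∀ ν : Measure E3, IsRootedHardCore δ ν → κ ν = ν := fun ν hν => by
    obtain ⟨S, -, hsep, rfl⟩ := hν
    exact hκ S hsep
  set g : Measure E3 → E3 → ℝ≥0∞ := fun ν y => Cᶜ.indicator 1 ((κ ν).map fun z : E3 => z - y) with hg
  have hgm : Measurable (Function.uncurry g) := (measurable_one.indicator hC.compl).comp (measurable_kernel_map_sub κ)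
  have hMTP := hstat g hgm
  -- the received mass vanishes almost surely: at an atom `y`, `θ_{-y} θ_y μ = μ ∈ C`
  have hR : ∫⁻ μ, ∫⁻ y, g (Measure.map (fun z => z - y) μ) (-y) ∂μ ∂P = 0 := by
    refine (lintegral_congr_ae ?_).trans lintegral_zero
    filter_upwards [hcore, h] with μ hμ hμC
    obtain ⟨S, h0S, hsep, hμS⟩ := id hμ
    have hS : ∀ᵐ y ∂μ, y ∈ S := by rw [hμS]; exact ae_mem_of_sep hδ hsep
    refine (lintegral_congr_ae ?_).trans lintegral_zero
    filter_upwards [hS] with y hy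
    have hyat : μ {y} ≠ 0 := by rw [hμS]; exact (count_restrict_singleton_ne_zero_iff S y).mpr hy
    have hθ : IsRootedHardCore δ (μ.map fun z : E3 => z - y) := hμ.map_sub hyat
    show Cᶜ.indicator 1 ((κ (Measure.map (fun z : E3 => z - y) μ)).map fun z : E3 => z - -y) = (0 : ℝ≥0∞)
    rw [hκ_of _ hθ, Measure.map_map (measurable_sub_const (-y)) (measurable_sub_const y)]
    have hid : ((fun z : E3 => z - -y) ∘ fun z : E3 => z - y) = id := by
      funext z
      simp only [Function.comp_apply, sub_neg_eq_add, sub_add_cancel, id_eq]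
    rw [hid, Measure.map_id]
    exact (indicator_compl_one_eq_zero_iff μ).mpr hμC
  rw [hR] at hMTP
  -- the sent mass: a.e. equal to a measurable function of `μ`, hence a.e. zero
  have hmeas : Measurable fun μ : Measure E3 => ∫⁻ y, g μ y ∂(κ μ) := Measurable.lintegral_kernel_prod_right hgm
  have hae_eq : (fun μ : Measure E3 => ∫⁻ y, g μ y ∂μ) =ᵐ[P] fun μ => ∫⁻ y, g μ y ∂(κ μ) := by
    filter_upwards [hcore] with μ hμ
    rw [hκ_of μ hμ]
  have hzero : ∀ᵐ μ ∂P, ∫⁻ y, g μ y ∂μ = 0 := by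
    have h0 : ∫⁻ μ, ∫⁻ y, g μ y ∂(κ μ) ∂P = 0 := by rwa [← lintegral_congr_ae hae_eq]
    have h1 := (lintegral_eq_zero_iff hmeas).mp h0
    filter_upwards [h1, hae_eq] with μ hμ1 hμ2
    rw [hμ2]
    exact hμ1
  filter_upwards [hcore, hzero] with μ hμ hz p hp
  obtain ⟨S, h0S, hsep, rfl⟩ := hμ
  have hpS : p ∈ S := (count_restrict_singleton_ne_zero_iff S p).mp hp
  simp only [hg, hκ S hsep] at hz
  exact (indicator_compl_one_eq_zero_iff _).mp ((lintegral_reroot_eq_zero_iff hδ hsep _).mp hz p hpS)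

/-- **Saturation iff** (the root is an atom). [folklore] -/
theorem ae_forall_reroot_iff_ae (hδ : 0 < δ) (hcore : ∀ᵐ μ ∂P, IsRootedHardCore δ μ) (hstat : IsPointStationaryLaw P)
    {C : Set (Measure E3)} (hC : MeasurableSet C) :
    (∀ᵐ μ ∂P, ∀ p : E3, μ {p} ≠ 0 → Measure.map (fun z : E3 => z - p) μ ∈ C) ↔ ∀ᵐ μ ∂P, μ ∈ C := by
  refine ⟨fun h => ?_, ae_forall_reroot_of_ae hδ hcore hstat hC⟩
  filter_upwards [hcore, h] with μ hμ hμC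
  have h0 : μ {0} ≠ 0 := by rw [hμ.measure_zero_singleton]; exact one_ne_zero
  have hid : Measure.map (fun z : E3 => z - 0) μ = μ := by
    have : (fun z : E3 => z - 0) = id := by funext z; simp only [sub_zero, id_eq]
    rw [this, Measure.map_id]
  simpa only [hid] using hμC 0 h0

/-! ## §2. Marks seen from some atom are seen from the root with positive probability -/

/-- **POSITIVE PALM PROBABILITY OF MARKS** (no distance bound, no ergodicity).  For a non-zero point-stationary law a.s. carried by rooted
`δ`-hard-core configurations and a measurable `D`: if almost surely SOME atom `p` has `θ_p μ ∈ D`, then `P D ≠ 0`. [folklore: mass transport] -/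
theorem measure_ne_zero_of_ae_exists_reroot (hδ : 0 < δ) (hcore : ∀ᵐ μ ∂P, IsRootedHardCore δ μ) (hstat : IsPointStationaryLaw P)
    {D : Set (Measure E3)} (hD : MeasurableSet D)
    (h : ∀ᵐ μ ∂P, ∃ p : E3, μ {p} ≠ 0 ∧ Measure.map (fun z : E3 => z - p) μ ∈ D) (hP : P ≠ 0) : P D ≠ 0 := by
  intro hD0
  have hae : ∀ᵐ μ ∂P, μ ∈ Dᶜ := measure_eq_zero_iff_ae_notMem.mp hD0
  have hsat := ae_forall_reroot_of_ae hδ hcore hstat hD.compl hae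
  have hfalse : ∀ᵐ μ ∂P, False := by
    filter_upwards [h, hsat] with μ hμ hs
    obtain ⟨p, hp, hpD⟩ := hμ
    exact hs p hp hpD
  exact hP (ae_eq_bot.mp (eventually_false_iff_eq_bot.mp hfalse))

/-! ## §3. The Palm dichotomy under the ergodicity clause -/

/-- **PALM DICHOTOMY.**  For a point-stationary probability law a.s. carried by rooted `δ`-hard-core configurations which satisfies the residual's
ergodicity clause (verbatim), and a measurable `C`: EITHER almost surely every atom's re-rooting lies in `C`, OR `P Cᶜ ≠ 0` (the root violates `C`
with positive probability). [folklore: ergodicity + mass transport] -/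
theorem ae_forall_reroot_or_measure_compl_ne_zero (hδ : 0 < δ) [IsProbabilityMeasure P] (hcore : ∀ᵐ μ ∂P, IsRootedHardCore δ μ)
    (hstat : IsPointStationaryLaw P)
    (herg : ∀ A : Set (MeasureTheory.Measure (EuclideanSpace ℝ (Fin 3))), MeasurableSet A → (∀ μ : MeasureTheory.Measure (EuclideanSpace ℝ (Fin 3)), ∀ p : EuclideanSpace ℝ (Fin 3), μ {p} ≠ 0 → (μ ∈ A ↔ MeasureTheory.Measure.map (fun z : EuclideanSpace ℝ (Fin 3) => z - p) μ ∈ A)) → P A = 0 ∨ P Aᶜ = 0)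
    {C : Set (Measure E3)} (hC : MeasurableSet C) :
    (∀ᵐ μ ∂P, ∀ p : E3, μ {p} ≠ 0 → Measure.map (fun z : E3 => z - p) μ ∈ C) ∨ P Cᶜ ≠ 0 := by
  obtain ⟨A, hAm, hAinv, hA⟩ := exists_version_forall_reroot hδ hC
  rcases herg A hAm hAinv with h0 | h0
  · right
    have hae : ∀ᵐ μ ∂P, μ ∉ A := measure_eq_zero_iff_ae_notMem.mp h0
    refine measure_ne_zero_of_ae_exists_reroot hδ hcore hstat hC.compl ?_ (IsProbabilityMeasure.ne_zero P)
    filter_upwards [hcore, hae] with μ hμ hμA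
    have hnot : ¬ ∀ p : E3, μ {p} ≠ 0 → Measure.map (fun z : E3 => z - p) μ ∈ C := fun hh => hμA ((hA μ hμ).mpr hh)
    obtain ⟨p, hp⟩ := not_forall.mp hnot
    obtain ⟨hp1, hp2⟩ := Classical.not_imp.mp hp
    exact ⟨p, hp1, hp2⟩
  · left
    have hae : ∀ᵐ μ ∂P, μ ∈ A := show A ∈ ae P from mem_ae_iff.mpr h0
    filter_upwards [hcore, hae] with μ hμ hμA
    exact (hA μ hμ).mp hμA

/-- The density form of the second alternative: if NOT almost every atom's re-rooting lies in `C`, then `0 < P.real Cᶜ`. [folklore] -/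
theorem measureReal_compl_pos_of_not_ae_forall_reroot (hδ : 0 < δ) [IsProbabilityMeasure P]
    (hcore : ∀ᵐ μ ∂P, IsRootedHardCore δ μ) (hstat : IsPointStationaryLaw P)
    (herg : ∀ A : Set (MeasureTheory.Measure (EuclideanSpace ℝ (Fin 3))), MeasurableSet A → (∀ μ : MeasureTheory.Measure (EuclideanSpace ℝ (Fin 3)), ∀ p : EuclideanSpace ℝ (Fin 3), μ {p} ≠ 0 → (μ ∈ A ↔ MeasureTheory.Measure.map (fun z : EuclideanSpace ℝ (Fin 3) => z - p) μ ∈ A)) → P A = 0 ∨ P Aᶜ = 0)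
    {C : Set (Measure E3)} (hC : MeasurableSet C)
    (hnot : ¬ ∀ᵐ μ ∂P, ∀ p : E3, μ {p} ≠ 0 → Measure.map (fun z : E3 => z - p) μ ∈ C) : 0 < P.real Cᶜ := by
  rcases ae_forall_reroot_or_measure_compl_ne_zero hδ hcore hstat herg hC with h | h
  · exact absurd h hnot
  · rw [measureReal_def]
    exact ENNReal.toReal_pos h (measure_ne_top P _)

/-! ## §4. The two-regime E′ assembly by name -/

/-- **COHERENT EVERYWHERE, OR A DENSITY OF DEFECT ROOTS.**  Under the residual's ergodicity clause, for a point-stationary probability law a.s.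
rooted `δ`-hard-core and a measurable root-local condition `C`: a ledger at level `c` for laws whose every atom satisfies `C` a.s., and a ledger at
level `c` for laws whose root violates `C` with positive probability, give a ledger at level `c`. [folklore: junction] -/
theorem nonempty_lawLedger_of_coherent_or_defectDensity (hδ : 0 < δ) [IsProbabilityMeasure P] {c : ℝ}
    (hcore : ∀ᵐ μ ∂P, IsRootedHardCore δ μ) (hstat : IsPointStationaryLaw P)
    (herg : ∀ A : Set (MeasureTheory.Measure (EuclideanSpace ℝ (Fin 3))), MeasurableSet A → (∀ μ : MeasureTheory.Measure (EuclideanSpace ℝ (Fin 3)), ∀ p : EuclideanSpace ℝ (Fin 3), μ {p} ≠ 0 → (μ ∈ A ↔ MeasureTheory.Measure.map (fun z : EuclideanSpace ℝ (Fin 3) => z - p) μ ∈ A)) → P A = 0 ∨ P Aᶜ = 0)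
    {C : Set (Measure E3)} (hC : MeasurableSet C)
    (hcoh : (∀ᵐ μ ∂P, ∀ p : E3, μ {p} ≠ 0 → Measure.map (fun z : E3 => z - p) μ ∈ C) → Nonempty (LawLedger P c))
    (hdef : 0 < P.real Cᶜ → Nonempty (LawLedger P c)) : Nonempty (LawLedger P c) := by
  by_cases h : ∀ᵐ μ ∂P, ∀ p : E3, μ {p} ≠ 0 → Measure.map (fun z : E3 => z - p) μ ∈ C
  · exact hcoh h
  · exact hdef (measureReal_compl_pos_of_not_ae_forall_reroot hδ hcore hstat herg hC h)

end Summit.AtomisticToContinuum.Crystallization.Theorems.FrustratedLawDichotomySignedLedgerSaturation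

end
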